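import Mathlib
import HarnessLib
import HarnessLib.Audit
import Summits.FinalStateConjecture.Statement
import Literature.Geometry.Lorentzian.CutBondiMass
import Literature.Geometry.Lorentzian.BondiMomentumCD

/-!
Route: NoNullFinalMomentum

DORMANT since 2026-09-04T16:53:32Z (reconciler: no traction for 5.1 d (last activity statement-checked at 2026-08-30T15:04:38Z); parked, not closed — `ledger route dormant route-FinalStateConjecture-NoNullFinalMomentum --off` to reactiv) — unstaffed, not closed; items shared with open routes are served there. `ledger route dormant <id> --off` reactivates.

# Route NoNullFinalMomentum — final Bondi rest-mass dichotomy — drained developments disperse (no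
luminal runaway), massive ones settle in their rest frame

It suffices to show X = DrainImpliesDisperse ∧ GenericMassiveSettle — the case split of the
conjecture on the one Lorentz-INVARIANT
scalar the Einstein flow leaves at infinity, the final Bondi REST mass m_∞ (typed, frame-free:
`HasVanishingFinalBondiMass` = "the
infimum over late cuts AND asymptotic frames of the Bondi energy is 0"). DrainImpliesDisperse (m_∞ =
0 ⇒ an honest N = 0
decomposition in the re-typed Statement's shape — rays stay in closure O, exhaustive charts with
honest radii, future-oriented chart time —
for ALL censored admissible developments; re-typed 2026-08-16 after Statement re-type T2, p126844;
before that shared verbatim with route BondiDrainDispersal) is where the card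
tsiolkovsky-at-scri-no-null-bondi-defects lives: its corner "m_∞ = 0 but lab energy E_∞ > 0" (final
four-momentum NULL, a luminal
runaway) is exactly what separates drain from dispersal, and the card's kill (rocket equation at 𝓘⁺
+ collimation costs bandwidth)
is the foreseen engine. GenericMassiveSettle (m_∞ > 0 ⇒ settles to sub-extremal Kerrs,
TAME-Christodoulou-generically on one fixed end
(`IsTameChristodoulouGeneric … 1`, re-type T2); the massive side has a rest frame by the rocket
bound) carries all the genericity. TrappedImpliesMassive (card K2, sign form of the Bondi–Penrose
inequality) pins every development with a trapped sphere to the massive side, so the all-data burden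
is horizonless and massless only.
Lean: `DrainImpliesDisperse ∧ GenericMassiveSettle`

## Assembly
Pure logic, compiled sorry-free in the planner's Sketch.lean and shipped as the deciding theorem
`closes` (axioms propext · Classical.choice ·
Quot.sound): fix X and an exceptional datum D of the Statement's property P; tame Christodoulou
genericity (`IsTameChristodoulouGeneric`) is monotone in
the property (the witnessing end e and family F are reused verbatim), so it suffices that the
property P' of GenericMassiveSettle implies P on the
admissible class; given an MGHD 𝒟, P' gives complete 𝓘⁺, and by
excluded middle either the final Bondi rest mass vanishes (DrainImpliesDisperse gives an N = 0
decomposition with O = exteriorOf, RaysStayInClosure,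
HasExhaustiveCharts and IsFutureOriented, whose sub-extremality clause is vacuous over Fin 0) or it
does not (P' gives the sub-extremal one
with the same four clauses). TrappedImpliesMassive and
RecoilRapidityBound are items but not hypotheses of `closes` (the former is the glue partner of the
foreseen split of DrainImpliesDisperse,
the latter a provable-now lemma); `closes : DrainImpliesDisperse → GenericMassiveSettle →
FinalStateConjecture` is crux-only (repair
2026-08-16: the Assembly item, the same implication, is no longer carried as a hypothesis — it is
proved BY `closes`).

Rationale: WHY THIS LINE. Read the vector Bondi mass-loss law dP = −F du (F future causal) as Ackeret's
relativistic rocket equation (Damour, doi:10.1088/0264-9381/12/3/011,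
(3.12)–(3.13); Bonnor–Piper arXiv:gr-qc/9702005): with m = √(−P·P) and rapidity θ, dθ ≤ d log(m₀/m),
so a positive final rest mass gives an
asymptotic rest frame with finite total rapidity variation (RecoilRapidityBound is the per-cut typed
instance), while m → 0 with E ↛ 0 needs
rest-frame collimation η → 1 of the exhaust, which band-limited news cannot supply (η(2) = 2/3, η(L)
≤ 1 − 4/(3L²)). Hence the natural dichotomy
of the conjecture is by final REST mass, not by horizon (BondiDrainDispersal) or by curvature clock
(ConcentrationCannotWait): on the massive
side only GENERIC statements are asked (no all-data no-soliton theorem), on the massless side only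
censored, trapped-surface-free content
remains once TrappedImpliesMassive (Ludvigsen–Vickers doi:10.1088/0305-4470/16/14/025, Bergqvist
doi:10.1088/0264-9381/14/9/013, Mars2009) is in.
Imported: special-relativistic rocket kinematics and antenna-bandwidth bounds (physics, with the
explicit dictionary news ↦ exhaust,
∮|N|²(1,ξ) ↦ thrust), positive-mass/Penrose geometry at 𝓘⁺ (Schoen–Yau, Ludvigsen–Vickers, Dong–Song
via the shared crux). New relative to the
pool: the rest-mass dichotomy with its pure-logic assembly, the trapped ⇒ massive hinge, and two
typing findings recorded under Definition
requests (data-anchored cones never reach late retarded time; `IsCanonical` permits frame drift dθ ≤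
dℓ, which fakes null final momenta),
which is why the card's K1 is filed informally pending the inertial late-cut four-momentum D1.

RANKED CRUXES. #2 DrainImpliesDisperse (crux) — (shared verbatim with BondiDrainDispersal,
stmt-FinalStateConjecture-9970) for every admissible datum and every maximal vacuum Cauchy
development with complete 𝓘⁺ (sojourn form): if the final Bondi rest mass vanishes
(`HasVanishingFinalBondiMass`: for every ε some compact K ⊆ M carries a round receding family on
∂J⁺(K) with Hawking masses eventually ≤ ε) then there are O and a C² final-state decomposition d
with d.N = 0, O = J⁺(ιX) ∩ I⁻(d.charted), every future-complete normalised null ray from the data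
staying in closure O (`RaysStayInClosure`), exhaustive charts with honest near-zone radii
(`HasExhaustiveCharts`, re-typed) and future-oriented chart time (`IsFutureOriented`) — the re-typed
Statement's conclusion with N = 0 (repair 2026-08-16 after re-type T2, p126844; until then shared
verbatim with BondiDrainDispersal's stmt-9970, whose re-typing is that route's to re-ask). In this
route it is the composite "no luminal runaway (card K1) + lab-energy drain disperses", restricted by
TrappedImpliesMassive to trapped-sphere-free developments. [difficulty: open-problem] (why it might
fail: All-data: a luminal runaway (rest mass → 0, lab energy E_∞ > 0: curvature ∼ γ²/m² in every
fixed frame, no C² flat chart) refutes it; so do a massless hole (horizon persisting while m_B ↓ 0),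
Burnett-type drain without C² flatness, and — new with RaysStayInClosure — a future-complete null
ray from Σ leaving closure(J⁺(Σ) ∩ I⁻(flat chart image)).) [DongSong2024, HirschKazarasKhuri2022,
Mars2009, LukOh2022, ChristodoulouKlainerman1993, arXiv:gr-qc/9702005, arXiv:1706.03732]
#4 TrappedImpliesMassive (crux) — (card K2 in sign form: the Bondi–Penrose inequality at its
weakest) for every admissible datum and every maximal vacuum Cauchy development with complete 𝓘⁺: if
some smoothly embedded 2-sphere to the causal future of the data is a closed trapped surface
(`IsTrappedSurface`: θ_L < 0 and θ_L̲ < 0 for every null normal pair), the final Bondi rest mass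
does NOT vanish (¬`HasVanishingFinalBondiMass`). With the rocket bound this gives every trapped
development an asymptotic rest frame; with DrainImpliesDisperse it confines the massless sector to
trapped-sphere-free developments. [difficulty: open-problem] (why it might fail: It is the
Bondi-mass Penrose inequality in sign form, open beyond symmetry (Ludvigsen–Vickers 1983 has a gap:
Bergqvist 1997; Mars 2009 §7): a 'massless hole' (horizon area ≥ A₀ while m_B ↓ 0) or a trapped
sphere visible from a merely sojourn-complete 𝓘⁺ refutes it.) [doi:10.1088/0305-4470/16/14/025,
doi:10.1088/0305-4470/15/9/007, doi:10.1088/0264-9381/14/9/013, Mars2009, Penrose1973]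
#5 GenericMassiveSettle (crux) — (card K4, the framed remainder; ALL genericity here) for every data
manifold X, TAME-Christodoulou-generically in the admissible class (`IsTameChristodoulouGeneric …
1`: tame codimension ≥ 1 on one fixed asymptotically flat end, immersed at the base datum; re-type
T2): an MGHD exists, and every MGHD has complete 𝓘⁺ and, IF its final Bondi rest mass does not
vanish (¬`HasVanishingFinalBondiMass` — then by the rocket bound the final four-momentum is timelike
and an asymptotic rest frame exists), admits O and a C² final-state decomposition d with every
(d.mass i, d.spin i) sub-extremal, O = J⁺(ιX) ∩ I⁻(d.charted), RaysStayInClosure, exhaustive charts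
with honest radii and future-oriented chart time. (= the re-typed Statement with its settling
conjunct weakened to 'massive ⇒ settles'; implied by BondiDrainDispersal's HorizonlessMustDrain +
GenericCensoredHolesSettle, but asks no all-data no-soliton theorem.) [difficulty: open-problem]
(why it might fail: = weak cosmic censorship + large-data Kerr stability/final-state uniqueness for
every non-drained MGHD, generically; known only for |a| ≪ M (Klainerman–Szeftel); dies on an OPEN
set of data forming naked singularities, eternal massive geons or non-Kerr end states.)
[DafermosLuk2017, KlainermanSzeftel2023, GiorgiKlainermanSzeftel2022,
DafermosHolzegelRodnianskiTaylor2021, RodnianskiShlapentokhRothman2023, Christodoulou1999]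
#9 RecoilRapidityBound (support) — (card (i) / momentum card P3, typed per cut; proved sorry-free in
the planner's Sketch.lean, to be landed in Theorems/) for every Cauchy development, every end e and
every canonical Bondi frame foliation 𝓕 (`IsCanonical e`) of data with vanishing ADM momentum
vector, at every retarded time u: 2·E_ADM·E_B(u) ≤ E_ADM² + m_B(u)², i.e. the Bondi four-momentum of
the cut lies within rapidity log(E_ADM/m_B(u)) of the data frame (cosh θ ≤ cosh log(E_ADM/m_B)).
One-step rocket inequality: ‖P_B(u)‖ ≤ E_ADM − E_B(u) (Ashtekar–Magnon-Ashtekar) and m² = E² − ‖P‖².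
[difficulty: provable-now] [doi:10.1103/PhysRevLett.43.181, doi:10.1088/0264-9381/12/3/011,
doi:10.12942/lrr-2009-4]

TWO-LAYER PLAN. Foreseen glued splits (k ≤ 3, depth 1; nothing filed as a split now). (a)
DrainImpliesDisperse ⇐ TrappedImpliesMassive →
UntrappedDrainDisperses → DrainImpliesDisperse, where UntrappedDrainDisperses = DrainImpliesDisperse
with the extra hypothesis "no closed
trapped sphere to the future of the data" (pure logic: drained ⇒ untrapped ⇒ disperse). (b) Once the
definition D1 (inertial late-cut
four-momentum) lands: UntrappedDrainDisperses ⇐ NoNullBondiDefects (card K1(a): along an inertial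
late-cut system, rest mass → 0 ⇒ lab
energy → 0; filed NOW as an informal rank-3 crux) → InertialDrainDisperses (lab energy → 0 in the
data's inertial frame ⇒ N = 0 charts;
immune to the luminal corner, it is the Dong–Song/Luk–Oh engine of BondiDrainDispersal in the frame
where it applies) → glue needing
InertialMomentumLaws (existence of the inertial system, informal rank-6 crux) — the card's own
decomposition. (c) NoNullBondiDefects ⇐
FramedPointedCompactness (limits of escaping sequences modulo ℝ₊ ⋉ ISO(3,1) are smooth isolated
vacuum developments) → CollimationBound
(their exhaust has rest-frame collimation η < 1: bandwidth lemma η(L) < 1 + smoothness) → rocket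
inequality (E ≤ m₀e^{θ₀}exp(−∫(1−η)dℓ),
provable real analysis). (d) GenericMassiveSettle ⇐ RestFrameSettle (massive ⇒ asymptotic rest frame
with finite rapidity variation,
provable from InertialMomentumLaws by the rocket bound) → FramedMassiveSettle (the frame-based
capture architecture of routes
QuietWindowCapture / TangentConeAtIPlus / AtomicSupermomentum run in that frame).

KILL CRITERIA. Close `refuted:DrainImpliesDisperse` if the witness is a LUMINAL RUNAWAY (censored,
trapped-free, m_B ↓ 0 with lab energy ↛ 0): that is
¬NoNullBondiDefects and the thesis named by this route is false (hand the witness to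
ConcentrationCannotWait as a BlowsUpAtInfinity species).
If the witness is a MASSLESS HOLE (trapped sphere present): TrappedImpliesMassive dies with it;
pivot by filing UntrappedDrainDisperses
(split (a) with the trapped case moved into GenericMassiveSettle's complement is no longer
available) — i.e. restate the dichotomy as
"untrapped ∧ drained ⇒ disperse" + "generic: trapped ∨ massive ⇒ settle". If the witness is
BURNETT-type (drains, flat only in C⁰/H¹):
weaken the conclusion norm together with BondiDrainDispersal and hand it to
burnett-limit-photons-kinetic-rigidity. GenericMassiveSettle
refuted (an open set of massive non-settling developments) ⇒ ¬FinalStateConjecture in substance;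
every route dies. TrappedImpliesMassive
refuted alone ⇒ drop it (not a hypothesis of `closes`) and record the massless-hole species in the
negatives index. Proved elsewhere:
BondiDrainDispersal proving DrainImpliesDisperse closes our rank 2; ConcentrationCannotWait's
NoBlowUpAtInfinity implies NoNullBondiDefects
for horizonless developments (a runaway core of rest mass → 0 has unbounded curvature invariants).

NOT DECOMPOSED YET. Card K1(b) (no null JUMPS of P_B at finite cuts: bullet landings) and K3 (does
the sojourn form of complete 𝓘⁺ see a landing?) are not
load-bearing for `closes` and are not filed; they belong to the censorship conjunct's audit. The
bandwidth lemma (top eigenvalue of the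
tridiagonal cos θ-multiplication matrices on spin-weight −2 harmonics ℓ ≤ L is < 1; η(2) = 2/3) and
the integrated rocket inequality are
layer-3 lemmas a prover attaches with `--supports NoNullBondiDefects`; not items. The self-similar
no-go (card P3: discretely self-similar
cores twisted by a boost crash at a finite event) is TangentProfileCensorship's jurisdiction.
UntrappedDrainDisperses, InertialDrainDisperses,
RestFrameSettle are named above but filed only when a crux closes or D1 lands (tenure). No constants
(ε-regularity thresholds, η(L) table)
are items.

CHEAPEST FALSIFIER. Three, cheapest first. (1) PENCIL, done this session, and it bit: over
`BondiFrameFoliation.IsCanonical` a u-dependent boost of the section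
frames with dθ/du ≤ d log(m₀/m)/du preserves every field (loss law, positivity, ADM limits at u →
−∞); on a dispersing small-data spacetime
θ = log(m₀/m) gives measured m → 0, E → m₀/2: a FAKE null final momentum — so the card's K1 cannot
be typed over the existing structure (hence
D1 and the informal filing); moreover every 'final…' quantity of the data-anchored foliations sits
at an intermediate cut. The typed layer 1
is immune (HasVanishingFinalBondiMass uses cones of compact K ⊆ M and is frame-free). (2)
LITERATURE, for refuters: Ludvigsen–Vickers 1982
(doi:10.1088/0305-4470/15/9/007) — if their spinor argument gives STRICT positivity M_B(u) ≥ c > 0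
uniformly to the future of a trapped
surface, TrappedImpliesMassive is 'known' modulo the sojourn-form typing; Bergqvist 1997 records the
gap in the 1983 area version.
(3) NUMERICS (kit, not run: hub compute-free): rest-frame collimation η(u) = |∮ξ|N|²|/∮|N|² of
public superkick waveforms — expected ≲ 0.05;
a trend η → 1 along a sequence of simulations would be the first evidence for the corner.

NUMBERS. Collimation of band-limited exhaust (card P2, Sturm bisection, this hub): η(2) = 2/3
exactly, η(3) = 0.8273, η(4) = 0.8920, η(10) = 0.9776,
η(40) = 0.998318, η(120) = 0.999804; (1 − η(L))L² increases from 4/3 towards ≈ 2.9. Recoil bound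
(RecoilRapidityBound): cosh θ ≤ (M² + m²)/(2Mm),
v ≤ (M² − m²)/(M² + m²). NR kicks ≤ 0.02c (Campanelli et al. 2007); Hawking two-hole radiated
fraction ≤ 1 − 1/√2. Kerr stability known for
|a|/M ≪ 1 (KlainermanSzeftel2023). Items at open: 5 typed (3 cruxes ranked 2/4/5, support, assembly)
+ 2 informal cruxes (ranks 3, 6)
+ 1 definition request filed right after open.

DEFINITION REQUESTS. D1 `InertialCutMomentum` (topic Literature/Geometry/Lorentzian, next to
CutBondiMass.lean / BondiMomentumCD.lean; filed --for NoNullBondiDefects).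
WHY: two typing findings of this session. (i) LATE CUTS: every Bondi foliation structure in the tree
(RadiatedEnergy.BondiFoliation, BondiMass,
BondiMassCauchy, BondiMomentumCD.BondiFrameFoliation, BondiNewsFlux, BondiSachsRadiativeEnd) uses
cones ∂J⁺(ι(B u)) of compact DATA pieces
B u ⊆ X, antitone in u; since ⋂ B u ∋ p₀ is non-empty, every such cone contains J⁺(ι p₀) and its cut
of 𝓘⁺ lies below the fixed cut of
C⁺(p₀) (Minkowski: the cut of ∂J⁺(B) satisfies c(ω) + c(−ω) ≤ 0), so
`finalBondiEnergy/Momentum/RestMass`, `finalBondiMass`, 'late mass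
aspect' are values at an INTERMEDIATE cut, never at i⁺; CutBondiMass (cones of compact K ⊆ M) is
correct. (ii) FRAME DRIFT: `IsCanonical`
ties the frame to the end e only at u → −∞; a u-dependent boost with dθ ≤ d log(m₀/m) keeps all its
fields (Cheapest falsifier (1)).
WHAT: (1) `CauchyDevelopment.LateCutSystem 𝒟`: K : ℕ → Set M compact, causally increasing (K (n+1) ⊆
J⁺(K n)), escaping to i⁺
(∀ C compact, ∀ᶠ n, C ⊆ I⁻(K n)), with fam n : RoundSectionFamily 𝒟 (K n); energies/momenta/rest
masses from the existing
massLimit/momentumLimit API. (2) `IsInertial e` (the tie to the data frame): eventually in s, for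
every ω ∈ S², (fam n).sec s ω lies on
the maximal timelike geodesic through ι(e.dataChart (s•ω)) with initial velocity 𝒟.normal — the
normal (Gaussian) congruence of the far
data labels directions and pins the boost (in Minkowski these sections are the lab-round spheres {t
= uₙ + s, |x| = s}; for AF developments
the far normal observers are asymptotically static). Acceptable alternatives: double-null tie
(sections C⁺(K n) ∩ C⁻(p_s) for one timelike
sequence p_s → i⁺ shared by all n) or BMS-charge frame fixing (doi:10.1103/PhysRevD.104.024051). (3)
`IsCanonicalLate e`: per-cone convergence,
‖P n − P (n+1)‖ ≤ E n − E (n+1), ‖P n‖ ≤ E n, ‖P 0‖ ≤ admEnergy e D − E 0. Sources: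
ChristodoulouKlainerman1993 Ch. 17; doi:10.12942/lrr-2009-4
§6.1; doi:10.1103/PhysRevLett.43.181. Informal cruxes filed after open over D1: NoNullBondiDefects
(rank 3), InertialMomentumLaws (rank 6).

Novelty: Searches (2026-08-15; local searchd rc 75, arXiv 429, crossref + galaxy used): `lit search --source
crossref "Penrose inequality Bondi mass
trapped surface"` (12: Ludvigsen–Vickers 1982/1983, Bergqvist 1997 via follow-up query, Malec–Ó
Murchadha 1994, Alaee–Lesourd–Yau 2023 —
per-cut/initial-data statements, none on the FINAL rest mass); `lit search --source crossref
"asymptotic rest frame final Bondi four-momentum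
timelike late retarded time"` (10, noise + Beig–Chruściel 1997 on timelike Killing AF spacetimes);
`lit galaxy search "Penrose inequality"
--star all` (16: Rendall, Heusler, Daudé–Häfner volumes; Khuri charged Penrose; none at 𝓘⁺ for the
final state); `lit galaxy search "Bondi
four-momentum" --star all` (7: Chruściel–Jezierski–Kijowski radiating-regime monograph; Mitman 2024
thesis on BMS FRAME FIXING — the
numerical-relativity face of finding (ii)); grep of the 45 theses of the sub for
HasVanishingFinalBondiMass|cutBondiMass|BondiFrameFoliation
(4 files: BondiDrainDispersal, BartnikGapSettling, AtomicSupermomentum, DissipativeFinalMotions —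
none splits on the final rest mass; none
states trapped ⇒ massive); the card's own log (rocket/collimation/null-limit queries, Damour photon
rocket found by its refuter); `ledger
negatives`: 0.
Nearest prior art found: route BondiDrainDispersal (same massless crux, HORIZON dichotomy, all-data
no-soliton theorem HorizonlessMustDrain);
doi:10.1088/0305-4470/16/14/025 + doi:10.1088/0264-9381/14/9/013 (Bondi-mass Penrose inequality  [refs: 10.1088/0305-4470/16/14/025, 10.1088/0264-9381/14/9/013, 10.1088/0264-9381/12/3/011, 10.1103/PhysRevD.104.024051, doi:10.1088/0305-4470/16/14/025, doi:10.1088/0264-9381/14/9/013, doi:10.1088/0264-9381/12/3/011, doi:10.1103/PhysRevD.104.024051]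

Barriers (technique_class: bondi-momentum-kinematics, rocket-inequality, dispersal): - technique_class: bondi-momentum-kinematics, rocket-inequality, dispersal
- Literature.Barriers.FinalStateConjecture.KehrbergerLogarithmicAsymptotics: harmless — only limits
of Hawking energies/momenta of round sections (the leading mass and momentum aspects) are used, no
peeling, no smooth conformal compactification, no NP constants; D1 asks convergence of exactly these
functionals, which polyhomogeneous 𝓘⁺ allows.
- Literature.Barriers.FinalStateConjecture.nakedSingularityInstability: every all-data crux
(DrainImpliesDisperse, TrappedImpliesMassive, the informal NoNullBondiDefects) assumes complete 𝓘⁺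
(censored developments only); censorship itself sits in GenericMassiveSettle with Christodoulou
genericity kept — nothing is claimed for all data about naked singularities.
- Literature.Barriers.FinalStateConjecture.WaveCoordinatesNullConditionFailure: not engaged — no
wave-coordinate small-data iteration; dispersal engines (Dong–Song/Luk–Oh) enter only through the
shared crux, from late nearly flat slices.
- Literature.Barriers.FinalStateConjecture.PriceLawTail: not engaged — rate-free limits of
monotone/causal quantities only; it binds the imported capture engines of GenericMassiveSettle,
declared not evaded.
- Literature.Barriers.FinalStateConjecture.SbierskiTrappingObstruction: same — no integrated local
energy decay statement is made here; binds GenericMassiveSettle's engines only.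
- Literature.Barriers.FinalStateConjecture.KerrSuperradiance: same — only superradiance-pr

History (route lifecycle, newest last):
- 2026-08-16T23:16:38Z · rev 2: restated DrainImpliesDisperse (stmt-FinalStateConjecture-9970), GenericMassiveSettle (stmt-FinalStateConjecture-11721) — route-repair (statement-revised p126844, re-type T2): RESTATE DrainImpliesDisperse (conclusion += RaysStayInClosure ∧ IsFutureOriented; HasExhaustiveCharts is t (planner-rrepair-FinalStateConjecture-NoNullFin-2758fa33-0)
- 2026-08-26T07:16:27Z · DORMANT — reconciler: no traction for 8.4 d (last activity item-evidence-added at 2026-08-17T21:23:10Z); parked, not closed — `ledger route dormant route-FinalStateConjec (operator:999:3668645)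
- 2026-08-30T14:34:20Z · REACTIVATED — reconciler: reactivated — activity item-evidence-added at 2026-08-30T13:26:22Z after parking at 2026-08-26T07:16:27Z (operator:999:3820437)
- 2026-09-04T16:53:32Z · DORMANT — reconciler: no traction for 5.1 d (last activity statement-checked at 2026-08-30T15:04:38Z); parked, not closed — `ledger route dormant route-FinalStateConjectu (operator:999:1090395)

sub-problem: FinalStateConjecture · status: dormant · opened planner-plancard-FinalStateConjecture-FinalSt-7590cb38-0 2026-08-15T18:39:44Z · rev 3 · ledger route-FinalStateConjecture-NoNullFinalMomentum
GENERATED by the gate from the ledger (D-0016/17). Provers cite these decls: `theorem foo : Summit.FinalStateConjecture.FinalStateConjecture.Theses.NoNullFinalMomentum.<Decl> := …` in Summits/FinalStateConjecture/FinalStateConjecture/Theorems/<Name>.lean.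
-/

namespace Summit.FinalStateConjecture.FinalStateConjecture.Theses.NoNullFinalMomentum

open scoped BigOperators Topology Manifold Classical MeasureTheory ProbabilityTheory Matrix InnerProductSpace ComplexConjugate ContinuousMap
open Filter Set Function TopologicalSpace MeasureTheory

attribute [summit_statement] _root_.FinalStateConjecture

-- earlier DrainImpliesDisperse (stmt-FinalStateConjecture-9970, replaced 2026-08-16T23:16:38Z -> stmt-FinalStateConjecture-17283): retired by None — ∀ (X : Type) [TopologicalSpace X] [ChartedSpace Literature.Geometry.Lorentzian.E3 X] [IsManifold (𝓡 3) ((⊤ : ℕ∞) : WithTop ℕ∞) X] [T2Space X] [SecondCountableTopology X] [ConnectedSpace X], ∀ D ∈ Literature.Geometry.Lorentzian.admissibleVacuumData X, ∀ 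
/-- item stmt-FinalStateConjecture-17283 · crux · rank 2 · open · by planner
why it might fail: All-data, REST-mass drain (inf over cuts AND frames): a luminal runaway (m_B ↓ 0, lab energy E_∞ > 0), a 'massless hole' (horizon persists, m_B ↓ 0), Burnett-type drain flat only in C⁰/H¹, or a future-complete null ray from Σ leaving closure(J⁺(Σ) ∩ I⁻(flat image)) each refute it.
sources: DongSong2024, LukOh2022, Mars2009, HirschKazarasKhuri2022, ChristodoulouKlainerman1993, arXiv:1907.10743
[crux] DrainImpliesDisperse (card pmt-almost-rigidity-bubbles-are-holes, spine; the second half of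
CensoredHorizonlessDisperse; rev 3: restated 1:1 after the Statement re-type T2, p126844). For EVERY
admissible datum D and EVERY maximal vacuum Cauchy development 𝒟 of D: if 𝒟 has complete future null
infinity (Summit.FinalStateConjecture.HasCompleteNullInfinity, sojourn form) and its Bondi mass
DRAINS — the final Bondi mass vanishes, `𝒟.toCauchyDevelopment.HasVanishingFinalBondiMass`
(CutBondiMass.lean, definition N1: for every ε > 0 some compact K ⊆ M whose cut 𝓘⁺ ∩ ∂J⁺(K) has
Bondi mass ≤ ε, the Bondi mass of a cut being the limit of the Hawking masses of asymptotically
round compact spacelike sections receding to infinity along frontier(J⁺(K))) — then 𝒟 carries an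
honest dispersive final-state decomposition, i.e. the re-typed Statement's N = 0 conclusion
verbatim: ∃ (O : Set 𝒟.carrier) (d : FinalStateDecomposition 𝒟.toSpacetime O 2), d.N = 0 ∧ O =
exteriorOf 𝒟 d.charted ∧ RaysStayInClosure 𝒟 O (every future-complete normalised null ray from X
stays in closure O) ∧ HasExhaustiveCharts d (growing honest radii; for N = 0: every point of O not
in the flat chart's late region is causa -/
@[route_item "route-FinalStateConjecture-NoNullFinalMomentum"]
def DrainImpliesDisperse : Prop :=
  ∀ (X : Type) [TopologicalSpace X] [ChartedSpace Literature.Geometry.Lorentzian.E3 X] [IsManifold (𝓡 3) ((⊤ : ℕ∞) : WithTop ℕ∞) X] [T2Space X] [SecondCountableTopology X] [ConnectedSpace X], ∀ D ∈ Literature.Geometry.Lorentzian.admissibleVacuumData X, ∀ 𝒟 : Literature.Geometry.Lorentzian.VacuumCauchyDevelopment D, 𝒟.IsMaximal → Summit.FinalStateConjecture.HasCompleteNullInfinity 𝒟.toCauchyDevelopment → 𝒟.toCauchyDevelopment.HasVanishingFinalBondiMass → ∃ (O : Set 𝒟.carrier) (d : Literature.Geometry.Lorentzian.FinalStateDecomposition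 𝒟.toSpacetime O 2), d.N = 0 ∧ O = Summit.FinalStateConjecture.exteriorOf 𝒟.toCauchyDevelopment d.charted ∧ Summit.FinalStateConjecture.RaysStayInClosure 𝒟.toCauchyDevelopment O ∧ Summit.FinalStateConjecture.HasExhaustiveCharts d ∧ Summit.FinalStateConjecture.IsFutureOriented d

/-- item stmt-FinalStateConjecture-11720 · crux · rank 4 · open · by planner
why it might fail: Sign form of the Bondi-mass Penrose inequality for ALL late cuts, open beyond symmetry and perturbed Schwarzschild cones (Ludvigsen–Vickers 1983 gap: Bergqvist 1997; Alexakis, Roesch): a 'massless hole' (horizon area ≥ A₀, m_B ↓ 0) or a trapped sphere visible from a sojourn-complete 𝓘⁺ refutes it.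
sources: doi:10.1088/0305-4470/16/14/025, doi:10.1088/0264-9381/14/9/013, Mars2009, Alexakis2015, Roesch2016, arXiv:2111.02993
[crux] (card K2 in sign form: the Bondi–Penrose inequality at its weakest) for every admissible
datum and every maximal vacuum Cauchy development with complete 𝓘⁺: if some smoothly embedded
2-sphere to the causal future of the data is a closed trapped surface (`IsTrappedSurface`: θ_L < 0
and θ_L̲ < 0 for every null normal pair), the final Bondi rest mass does NOT vanish
(¬`HasVanishingFinalBondiMass`). With the rocket bound this gives every trapped development an
asymptotic rest frame; with DrainImpliesDisperse it confines the massless sector to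
trapped-sphere-free developments. [difficulty: open-problem] -/
@[route_item "route-FinalStateConjecture-NoNullFinalMomentum"]
def TrappedImpliesMassive : Prop :=
  ∀ (X : Type) [TopologicalSpace X] [ChartedSpace Literature.Geometry.Lorentzian.E3 X] [IsManifold (𝓡 3) ((⊤ : ℕ∞) : WithTop ℕ∞) X] [T2Space X] [SecondCountableTopology X] [ConnectedSpace X], ∀ D ∈ Literature.Geometry.Lorentzian.admissibleVacuumData X, ∀ 𝒟 : Literature.Geometry.Lorentzian.VacuumCauchyDevelopment D, 𝒟.IsMaximal → Summit.FinalStateConjecture.HasCompleteNullInfinity 𝒟.toCauchyDevelopment → (∀ [𝒟.metric.HasLeviCivita], ∃ f : Metric.sphere (0 : Literature.Geometry.Lorentzian.E3) 1 → 𝒟.carrier, Set.range f ⊆ 𝒟.metric.causalFuture 𝒟.timeOrientation (Set.range 𝒟.embed) ∧ 𝒟.metric.IsTrappedSurface (𝓡 2) 𝒟.timeOrientation f) → ¬ 𝒟.toCauchyDevelopment.HasVanishingFinalBondiMass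

-- earlier GenericMassiveSettle (stmt-FinalStateConjecture-11721, replaced 2026-08-16T23:16:38Z -> stmt-FinalStateConjecture-17345): retired by None — ∀ (X : Type) [TopologicalSpace X] [ChartedSpace Literature.Geometry.Lorentzian.E3 X] [IsManifold (𝓡 3) ((⊤ : ℕ∞) : WithTop ℕ∞) X] [T2Space X] [SecondCountableTopology X] [ConnectedSpace X], Literature.Geometry.Lorentzian.InitialDataSet.IsChristodoulouG
/-- item stmt-FinalStateConjecture-17345 · crux · rank 5 · open · by planner
why it might fail: = WCC + MGHD existence + large-data Kerr stability / final-state uniqueness for every non-drained MGHD, TAME-generically (witness families on one fixed end: no burial at infinity); Kerr stability known only for |a| ≪ M: an OPEN set of data with naked singularities or non-Kerr end states refutes it.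
sources: DafermosLuk2017, KlainermanSzeftel2023, GiorgiKlainermanSzeftel2022, DafermosHolzegelRodnianskiTaylor2021, RodnianskiShlapentokhRothman2023, Christodoulou1999
[crux] GenericMassiveSettle — RE-TYPED 2026-08-16 (Statement re-type T2, p126844; card K4, the
framed remainder; ALL genericity of the route lives here). For every data manifold X,
TAME-Christodoulou-generically in the admissible class (InitialDataSet.IsTameChristodoulouGeneric
(admissibleVacuumData X) · 1: through every exceptional admissible datum d passes an injective
one-parameter family F of admissible data, F 0 = d, tame on ONE fixed asymptotically flat end e of X
— jointly smooth, Dafermos–Rodnianski rates with a continuous mass M(c), e.wDist-continuous at c = 0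
— and immersed at c = 0, all of whose other members are good): an MGHD exists, and every MGHD has
complete 𝓘⁺ (sojourn form) and, IF its final Bondi rest mass does not vanish
(¬HasVanishingFinalBondiMass — then by the rocket bound the final four-momentum is timelike and an
asymptotic rest frame exists), admits O and a C² final-state decomposition d with every (d.mass i,
d.spin i) sub-extremal, O = exteriorOf 𝒟 d.charted, RaysStayInClosure 𝒟 O, HasExhaustiveCharts d
(honest near-zone radii Rᵢ(τ) ≥ max(r₊(Mᵢ,aᵢ),0) + 1, Rᵢ → ∞, near-zone C² convergence out to Rᵢ,
every point of O outside the certified late region causa -/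
@[route_item "route-FinalStateConjecture-NoNullFinalMomentum"]
def GenericMassiveSettle : Prop :=
  ∀ (X : Type) [TopologicalSpace X] [ChartedSpace Literature.Geometry.Lorentzian.E3 X] [IsManifold (𝓡 3) ((⊤ : ℕ∞) : WithTop ℕ∞) X] [T2Space X] [SecondCountableTopology X] [ConnectedSpace X], Literature.Geometry.Lorentzian.InitialDataSet.IsTameChristodoulouGeneric (Literature.Geometry.Lorentzian.admissibleVacuumData X) (fun D ↦ (∃ 𝒟 : Literature.Geometry.Lorentzian.VacuumCauchyDevelopment D, 𝒟.IsMaximal) ∧ ∀ 𝒟 : Literature.Geometry.Lorentzian.VacuumCauchyDevelopment D, 𝒟.IsMaximal → Summit.FinalStateConjecture.HasCompleteNullInfinity 𝒟.toCauchyDevelopment ∧ (¬ 𝒟.toCauchyDevelopment.HasVanishingFinalBondiMass → ∃ (O : Set 𝒟.carrier) (d : Literature.Geometry.Lorentzian.FinalStateDecomposition 𝒟.toSpacetime O 2), (∀ i, Literature.Geometry.Lorentzian.Kerr.IsSubextremal (d.mass i) (d.spin i)) ∧ O = Summit.FinalStateConjecture.exteriorOf 𝒟.toCauchyDevelopment d.charted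 ∧ Summit.FinalStateConjecture.RaysStayInClosure 𝒟.toCauchyDevelopment O ∧ Summit.FinalStateConjecture.HasExhaustiveCharts d ∧ Summit.FinalStateConjecture.IsFutureOriented d)) 1

-- item stmt-FinalStateConjecture-11858 · support · rank 3 · open · by planner — informal only, no Lean statement yet:
--   [crux] NoNullBondiDefects (card tsiolkovsky-at-scri-no-null-bondi-defects K1(a), the line's named
--   bet; informal until definition request D1 `InertialCutMomentum` lands — it CANNOT be typed over
--   BondiFrameFoliation.IsCanonical: (i) cones ∂J⁺(ι(B u)) of data pieces never reach late retarded
--   time, (ii) IsCanonical permits a u-dependent boost drift dθ ≤ d log(m₀/m) that fakes a null final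
--   momentum on a dispersing spacetime; see the route's Definition requests / Cheapest falsifier).
--   STATEMENT: for every admissible datum D, every maximal vacuum Cauchy development 𝒟 of D with
--   complete future null inf

-- item stmt-FinalStateConjecture-11883 · support · rank 6 · open · by planner — informal only, no Lean statement yet:
--   [crux] InertialMomentumLaws (construction statement for the interface of definition request D1
--   `InertialCutMomentum`; = MergerLatticeBudget's informal LeafBudgetLaws (i) moved from data-anchored
--   cones to LATE cuts and tied to the data frame; informal until D1 lands). STATEMENT: every maximal
--   vacuum Cauchy development 𝒟 of an admissible datum D with complete future null infinity (sojourn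
--   form) ADMITS an inertial canonical late-cut system for the (sole) end e of D: compact K_n ⊆ M,
--   causally increasing, escaping to i⁺ (∀ compact C, eventually C ⊆ I⁻(K_n)); on each cone ∂J⁺(K_n) a
--   round receding f

/-- item stmt-FinalStateConjecture-11722 · support · rank 9 · open · by planner
sources: doi:10.1103/PhysRevLett.43.181, doi:10.1088/0264-9381/12/3/011, doi:10.12942/lrr-2009-4
[support] (card (i) / momentum card P3, typed per cut; proved sorry-free in the planner's
Sketch.lean, to be landed in Theorems/) for every Cauchy development, every end e and every
canonical Bondi frame foliation 𝓕 (`IsCanonical e`) of data with vanishing ADM momentum vector, at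
every retarded time u: 2·E_ADM·E_B(u) ≤ E_ADM² + m_B(u)², i.e. the Bondi four-momentum of the cut
lies within rapidity log(E_ADM/m_B(u)) of the data frame (cosh θ ≤ cosh log(E_ADM/m_B)). One-step
rocket inequality: ‖P_B(u)‖ ≤ E_ADM − E_B(u) (Ashtekar–Magnon-Ashtekar) and m² = E² − ‖P‖².
[difficulty: provable-now] -/
@[route_item "route-FinalStateConjecture-NoNullFinalMomentum"]
def RecoilRapidityBound : Prop :=
  ∀ (X : Type) [TopologicalSpace X] [ChartedSpace Literature.Geometry.Lorentzian.E3 X] [IsManifold (𝓡 3) ((⊤ : ℕ∞) : WithTop ℕ∞) X] [ConnectedSpace X] (D : Literature.Geometry.Lorentzian.InitialDataSet (𝓡 3) X) (𝒟 : Literature.Geometry.Lorentzian.CauchyDevelopment D) (e : Literature.Geometry.Lorentzian.AFEnd X) (𝓕 : 𝒟.BondiFrameFoliation), 𝓕.IsCanonical e → Literature.Geometry.Lorentzian.AFEnd.admMomentumVec e D = 0 → ∀ u : ℝ, 2 * Literature.Geometry.Lorentzian.AFEnd.admEnergy e D * 𝓕.bondiEnergy u ≤ Literature.Geometry.Lorentzian.AFEnd.admEnergy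 e D ^ 2 + 𝓕.bondiRestMass u ^ 2

/-- item stmt-FinalStateConjecture-11723 · assembly · rank 1 · open · by planner
sources: Christodoulou1999, DafermosLuk2017
[assembly] DrainImpliesDisperse → GenericMassiveSettle → FinalStateConjecture (monotonicity of
IsChristodoulouGeneric in the property + case split on HasVanishingFinalBondiMass). -/
@[route_item "route-FinalStateConjecture-NoNullFinalMomentum"]
def Assembly : Prop :=
  DrainImpliesDisperse → GenericMassiveSettle → _root_.FinalStateConjecture

/-! D-0027 §2.1 — DECIDING THEOREM (planner-authored via `route open/edit --closes-file`; by planner-rbadge-FinalStateConjecture-NoNullFina-aca8993c-0 2026-08-16T23:42:17Z):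
its hypotheses are this route's items and its conclusion the sub-problem Statement (glue_lint), and it elaborates with this file. -/

@[closes "route-FinalStateConjecture-NoNullFinalMomentum"] theorem closes : DrainImpliesDisperse → GenericMassiveSettle → _root_.FinalStateConjecture := by
  intro hA hG X _ _ _ _ _ _ D hD
  -- `key`: on the admissible class, GenericMassiveSettle's property P' ("massive ⇒ settles")
  -- implies the Statement's property P ("settles"): excluded middle on the final Bondi rest mass;
  -- in the drained case DrainImpliesDisperse gives the N = 0 decomposition (sub-extremality is
  -- vacuous over `Fin 0`), in the massive case P' itself gives the sub-extremal one.
  have key : ∀ D' ∈ Literature.Geometry.Lorentzian.admissibleVacuumData X,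
      ((∃ 𝒟 : Literature.Geometry.Lorentzian.VacuumCauchyDevelopment D', 𝒟.IsMaximal) ∧
        ∀ 𝒟 : Literature.Geometry.Lorentzian.VacuumCauchyDevelopment D', 𝒟.IsMaximal →
          Summit.FinalStateConjecture.HasCompleteNullInfinity 𝒟.toCauchyDevelopment ∧
          (¬ 𝒟.toCauchyDevelopment.HasVanishingFinalBondiMass →
            ∃ (O : Set 𝒟.carrier) (d : Literature.Geometry.Lorentzian.FinalStateDecomposition 𝒟.toSpacetime O 2),
              (∀ i, Literature.Geometry.Lorentzian.Kerr.IsSubextremal (d.mass i) (d.spin i)) ∧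
              O = Summit.FinalStateConjecture.exteriorOf 𝒟.toCauchyDevelopment d.charted ∧
              Summit.FinalStateConjecture.RaysStayInClosure 𝒟.toCauchyDevelopment O ∧
              Summit.FinalStateConjecture.HasExhaustiveCharts d ∧
              Summit.FinalStateConjecture.IsFutureOriented d)) →
      ((∃ 𝒟 : Literature.Geometry.Lorentzian.VacuumCauchyDevelopment D', 𝒟.IsMaximal) ∧
        ∀ 𝒟 : Literature.Geometry.Lorentzian.VacuumCauchyDevelopment D', 𝒟.IsMaximal →
          Summit.FinalStateConjecture.HasCompleteNullInfinity 𝒟.toCauchyDevelopment ∧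
            ∃ (O : Set 𝒟.carrier) (d : Literature.Geometry.Lorentzian.FinalStateDecomposition 𝒟.toSpacetime O 2),
              (∀ i, Literature.Geometry.Lorentzian.Kerr.IsSubextremal (d.mass i) (d.spin i)) ∧
              O = Summit.FinalStateConjecture.exteriorOf 𝒟.toCauchyDevelopment d.charted ∧
              Summit.FinalStateConjecture.RaysStayInClosure 𝒟.toCauchyDevelopment O ∧
              Summit.FinalStateConjecture.HasExhaustiveCharts d ∧
              Summit.FinalStateConjecture.IsFutureOriented d) := by
    intro D' hD' h
    refine ⟨h.1, fun 𝒟 h𝒟 ↦ ⟨(h.2 𝒟 h𝒟).1, ?_⟩⟩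
    by_cases hM : 𝒟.toCauchyDevelopment.HasVanishingFinalBondiMass
    · obtain ⟨O, d, hN, hO, hR, hE, hF⟩ := hA X D' hD' 𝒟 h𝒟 (h.2 𝒟 h𝒟).1 hM
      exact ⟨O, d, fun i ↦ (Fin.cast hN i).elim0, hO, hR, hE, hF⟩
    · exact (h.2 𝒟 h𝒟).2 hM
  -- tame Christodoulou genericity is monotone in the property on the admissible class: the
  -- witnessing end `e` and immersed injective family `F` through the exceptional datum are reused.
  obtain ⟨e, F, hT, hI, h0, hinj, hF𝓓, hE⟩ := hG X D ⟨hD.1, fun h ↦ hD.2 (key D hD.1 h)⟩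
  exact ⟨e, F, hT, hI, h0, hinj, hF𝓓, fun c hc hmem ↦ hE c hc ⟨hmem.1, fun h ↦ hmem.2 (key _ hmem.1 h)⟩⟩

end Summit.FinalStateConjecture.FinalStateConjecture.Theses.NoNullFinalMomentum
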